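/-
Width seat `ym-line-cbag-p1-w3` (prover-ym-line-cbag-p1-w3-g8-0; own items stmt-QuantumFields-22254 `BoxFloorAllGroups` /
stmt-QuantumFields-22893 `ExpChartPackage2` CLOSED proved), helping LINE 3 `route-QuantumFields-SixPlaneColdBox`
(crux stmt-QuantumFields-25708 `TorusMeanNearColdBoxG`, skeleton `Cruxes/TorusMeanNearColdBoxG/Lines/birth.lean` stub 2
`stub_nestedBoxMeansAgreeG`; crux stmt-QuantumFields-25709 `DensityTransferG`): the FLAT-datum instance of the sharp kernel-mean expansion
and the nested-cold-box comparison of centre-plaquette means, every plane, every compact simple `G`.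
-/
import Summits.QuantumFields.YangMills.Theorems.SixPlaneColdBoxKernelMeanSharpG
import Summits.QuantumFields.YangMills.Theorems.WeakCouplingRatesBulkDominatesColdBoxWDirKernelDiagFlat
import Summits.QuantumFields.YangMills.Theorems.EquipartitionCriticalityFreeEnergyLogCoefficientExpChartBasic

/-!
# LINE 3 `SixPlaneColdBox`, glue «KernelMeanSharpG», part 3: the cold-wall box mean to precision `β^{−5/4}` (flat datum, every plane)
# and the nested-box comparison `stub_nestedBoxMeansAgreeG` (ceiling `θ' ≤ 1/200`)

The flat datum `ω ≡ 1` of the box kernel is the leaf's cold-wall box state (`boxKernelG_one`), it is crude-good (`crudeGoodG_one`), and its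
exponential-chart package is the trivial one: gauge `g ≡ 1`, chart coordinates `ϑ = 0` (`forestFix` of the flat configuration is flat,
`expChart ρ 0 = 1`), competitor `s = 0` (Maxwell energy `0`).  Feeding it to `kernelMeanSharpG_of_package` (part 2) kills the background term
and gives, for every faithful continuous unitary `ρ : G →* U(N)` and `0 < θ ≤ 1/200`, eventually in `β`, at every base point within `H/8` of the
centre and in every plane `i < j` (`H = ⌈β^θ⌉`, `D = dimE ρ`):

* **`flatBoxMean_sharp`** — `|β·E_{boxState ρ β H}[c_{(x;i,j)}] − (D/2)·V_D(x;i,j;H)| ≤ β^{−1/4}`, `V_D = boxDirProjKernel H`;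

and, with the landed Dirichlet-vs-`ℤ⁴` comparison of the curvature kernel (`exists_boxDirProjKernel_sub_curl_bound` + `curl_greenTensor_self`:
`|V_D(centre;i,j;H) − V_D(centre;i,j;H')| ≤ K/H⁴ + K/H'⁴` for `H, H' ≥ 32`):

* **`nestedBoxMeansAgreeG`** — for every compact simple `G`, every `r : LatticeRep G` and exponents `0 < A < θ ≤ θ' ≤ 1/200` there is a
  margin `m > 0` with, for all large `β` and every plane `i < j`,
  `E_{box ⌈β^θ'⌉}[c_{(centre;i,j)}] − E_{box ⌈β^θ⌉}[c_{(centre;i,j)}] ≤ β^{−(1+4A+m)}`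
  — the statement of stub 2 `stub_nestedBoxMeansAgreeG` of the birth skeleton of crux `TorusMeanNearColdBoxG` with the ceiling `1/100`
  replaced by the mean engine's `1/200` (the skeleton's top scale `θ₁` is free, so the composition `TorusMeanNearColdBoxG_of` is unaffected
  once stub 1 is taken at `θ₁ ≤ 1/200`); in fact the difference is `≤ 2β^{−5/4} + D·K·β^{−1−4θ}` in absolute value (`abs_nestedBoxMeans_sub_le`).

No sorry; no new definition; standard axioms.  NOT a claim about the Yang–Mills mass gap: glue for a LINE onto the RECORD-type node
`LatticeNonFreezing`; crux `TorusMeanNearColdBoxG` (its stub 1, the torus-vs-top-box infrared input) stays OPEN and no summit statement is touched.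
-/

set_option autoImplicit false

noncomputable section

open MeasureTheory ProbabilityTheory Finset Real Filter Topology Metric
open scoped ENNReal
open Literature.Probability.LatticeModels (Site glueWith)
open Literature.MathematicalPhysics.QuantumLattice
open Literature.MathematicalPhysics.QuantumFieldTheory
open Literature.MathematicalPhysics.QuantumFieldTheory.LatticeMaxwell
open Literature.MathematicalPhysics.QuantumFieldTheory.AxialGauge
open Summit.QuantumFields.YangMills.Theorems.WeakCouplingRates
open Summit.QuantumFields.YangMills.Theorems.FreeEnergyLogCoefficient

namespace Summit.QuantumFields.YangMills.Theorems.ColdBoxAllGroups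

/-! ## The trivial chart package of the flat datum -/

section FlatPackage

variable {G : Type} [Group G]

/-- The temporal product of the flat configuration is `1`. -/
theorem tProd_one : ∀ (m : ℕ) (x : Site 4), tProd (fun _ : Literature.MathematicalPhysics.QuantumLattice.ZdEdge 4 => (1 : G)) m x = 1 := by
  intro m
  induction m with
  | zero => intro x; rfl
  | succ m ih => intro x; simp only [tProd, ih, mul_one]

/-- The temporal-forest gauge function of the flat configuration is `1`. -/
theorem forestGauge_one (H : ℕ) (x : Site 4) :
    forestGauge H (fun _ : Literature.MathematicalPhysics.QuantumLattice.ZdEdge 4 => (1 : G)) x = 1 := by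
  unfold forestGauge
  split_ifs
  · rw [tProd_one, inv_one]
  · rfl

/-- The forest-fixed flat configuration is flat. -/
theorem forestFix_one (H : ℕ) :
    forestFix H (fun _ : Literature.MathematicalPhysics.QuantumLattice.ZdEdge 4 => (1 : G)) = fun _ => 1 := by
  funext e
  rw [forestFix_apply, forestGauge_one, forestGauge_one]
  simp

/-- The truncated gauge copy of the flat datum under the trivial gauge is flat. -/
theorem glueWith_gaugeTransformZd_one_one (Λ : Finset (Literature.MathematicalPhysics.QuantumLattice.ZdEdge 4)) :
    glueWith Λ (fun e' : ↥Λ => gaugeTransformZd (fun _ : Site 4 => (1 : G))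
        (fun _ : Literature.MathematicalPhysics.QuantumLattice.ZdEdge 4 => (1 : G)) e'.1)
      (fun _ => 1) = fun _ => 1 := by
  funext e
  by_cases he : e ∈ Λ
  · rw [Literature.Probability.LatticeModels.glueWith_apply_mem _ _ _ he]
    simp [gaugeTransformZd]
  · rw [Literature.Probability.LatticeModels.glueWith_apply_not_mem _ _ _ he]

/-- The background circulation of the zero datum vanishes: `sCirc (glue 0 (mean 0)) p = 0`. -/
theorem sCirc_glue_zero_mean_zero (H : ℕ) (p : Plaq 4) :
    sCirc (glue (pin := fun e => e ∉ dirFreeEdges H) dirCorner (2 * H + 3) (0 : Literature.MathematicalPhysics.QuantumLattice.ZdEdge 4 → ℝ)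
      (mean (fun e => e ∉ dirFreeEdges H) dirCorner (2 * H + 3) (0 : Literature.MathematicalPhysics.QuantumLattice.ZdEdge 4 → ℝ))) p = 0 := by
  rw [mean_zero_dir]
  simp [sCirc, glue_zero_eq_sum]

/-- The Maxwell energy of the zero competitor with zero datum vanishes. -/
theorem formM_zero_zero (H : ℕ) :
    formM (fun e => e ∉ dirFreeEdges H) dirCorner (2 * H + 3) (0 : Literature.MathematicalPhysics.QuantumLattice.ZdEdge 4 → ℝ)
      (0 : DirFree H → ℝ) = 0 := by
  rw [formM_zero_eq]
  simp

end FlatPackage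

/-! ## The cold-wall box mean to precision `β^{−5/4}`, every plane -/

section Box

variable {N : ℕ} [NeZero N] {G : Type} [Group G] [TopologicalSpace G] [IsTopologicalGroup G] [CompactSpace G]
  [MeasurableSpace G] [BorelSpace G]
variable (ρ : G →* Matrix (Fin N) (Fin N) ℂ)

/-- **The cold-wall box mean of a plaquette cost is its Dirichlet–Gaussian value up to `β^{−1/4}` (in `β`-units), every plane.**  For a
faithful continuous unitary `ρ : G →* U(N)` (`N ≥ 1`) and `0 < θ ≤ 1/200`: eventually in `β`, at every base point `x` within `H/8` of the
centre of the cold box `H = ⌈β^θ⌉` and in every plane `i < j`,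
`|β·∫ c_{(x;i,j)} d(boxState ρ β H) − (D/2)·boxDirProjKernel H (x;i,j) (x;i,j)| ≤ β^{−1/4}` (`D = dimE ρ`).  The flat datum's chart package is
`(g, ϑ, s) = (1, 0, 0)` in `kernelMeanSharpG_of_package`. -/
theorem flatBoxMean_sharp (hρc : Continuous ρ) (hinj : Function.Injective ρ)
    (hρu : ∀ g, ρ g ∈ Matrix.unitaryGroup (Fin N) ℂ) {θ : ℝ} (hθ : 0 < θ) (hθ2 : θ ≤ 1 / 200) :
    ∃ β₀ : ℝ, ∀ β : ℝ, β₀ ≤ β →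
      ∀ x : Site 4, (∀ k : Fin 4, 8 * |x k - (⌈β ^ θ⌉₊ : ℤ)| ≤ (⌈β ^ θ⌉₊ : ℤ)) → ∀ (i j : Fin 4), i < j →
        |β * (∫ U, plaqCostAt ρ x i j U ∂(boxState ρ β ⌈β ^ θ⌉₊)) -
            (dimE ρ : ℝ) / 2 * boxDirProjKernel ⌈β ^ θ⌉₊ (x, i, j) (x, i, j)| ≤ β ^ (-(1 / 4 : ℝ)) := by
  obtain ⟨β₀, h⟩ := kernelMeanSharpG_of_package ρ hρc hinj hρu hθ hθ2 (Ca := 1) one_pos 1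
  refine ⟨max β₀ 0, fun β hβ x hx i j hij => ?_⟩
  have hb₀ : β₀ ≤ β := (le_max_left _ _).trans hβ
  have hβ0 : 0 ≤ β := (le_max_right _ _).trans hβ
  -- the trivial package of the flat datum
  have hω : CrudeGoodG ρ β (θ / 5) ⌈β ^ θ⌉₊ (fun _ => 1) := crudeGoodG_one ρ hβ0 _
  have hW : ∀ e, forestFix ⌈β ^ θ⌉₊ (glueWith (boxEdgesAt dirCorner (2 * ⌈β ^ θ⌉₊ + 3))
      (fun e' : ↥(boxEdgesAt dirCorner (2 * ⌈β ^ θ⌉₊ + 3)) => gaugeTransformZd (fun _ : Site 4 => (1 : G))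
        (fun _ : Literature.MathematicalPhysics.QuantumLattice.ZdEdge 4 => (1 : G)) e'.1) (fun _ => 1)) e =
      expChart ρ (datVec (0 : Fin (dimE ρ) → Literature.MathematicalPhysics.QuantumLattice.ZdEdge 4 → ℝ) e) := fun e => by
    rw [glueWith_gaugeTransformZd_one_one, forestFix_one, datVec_zero, Pi.zero_apply, expChart_zero ρ hρc hinj]
  have hϑr : ∀ e, ‖datVec (0 : Fin (dimE ρ) → Literature.MathematicalPhysics.QuantumLattice.ZdEdge 4 → ℝ) e‖ ≤
      1 * β ^ (3 * θ + θ / 5 - 1 / 2) := fun e => by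
    rw [datVec_zero, Pi.zero_apply, norm_zero]; positivity
  have hforest : ∀ y : Site 4, (∀ k : Fin 4, 1 ≤ y k ∧ y k + 1 ≤ 2 * (⌈β ^ θ⌉₊ : ℤ)) →
      ∀ c, (0 : Fin (dimE ρ) → Literature.MathematicalPhysics.QuantumLattice.ZdEdge 4 → ℝ) c (y, 0) = 0 := fun _ _ _ => rfl
  have hE : ∑ c, formM (fun e => e ∉ dirFreeEdges ⌈β ^ θ⌉₊) dirCorner (2 * ⌈β ^ θ⌉₊ + 3)
      ((0 : Fin (dimE ρ) → Literature.MathematicalPhysics.QuantumLattice.ZdEdge 4 → ℝ) c) ((0 : Fin (dimE ρ) → DirFree ⌈β ^ θ⌉₊ → ℝ) c) ≤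
      1 * (2 * (⌈β ^ θ⌉₊ : ℝ) + 3) ^ 4 * β ^ (2 * (θ / 5) - 1) := by
    have h0 : ∑ c, formM (fun e => e ∉ dirFreeEdges ⌈β ^ θ⌉₊) dirCorner (2 * ⌈β ^ θ⌉₊ + 3)
        ((0 : Fin (dimE ρ) → Literature.MathematicalPhysics.QuantumLattice.ZdEdge 4 → ℝ) c) ((0 : Fin (dimE ρ) → DirFree ⌈β ^ θ⌉₊ → ℝ) c) = 0 :=
      Finset.sum_eq_zero fun c _ => by simp only [Pi.zero_apply]; exact formM_zero_zero _
    rw [h0]; positivity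
  have key := h β hb₀ (fun _ => 1) (fun _ => 1) 0 0 hω hW hϑr hforest hE x hx i j hij
  -- the background term of the zero datum vanishes
  have hF : ∑ c, sCirc (glue (pin := fun e => e ∉ dirFreeEdges ⌈β ^ θ⌉₊) dirCorner (2 * ⌈β ^ θ⌉₊ + 3)
      ((1 / Real.sqrt 2) • (0 : Fin (dimE ρ) → Literature.MathematicalPhysics.QuantumLattice.ZdEdge 4 → ℝ) c)
      (mean (fun e => e ∉ dirFreeEdges ⌈β ^ θ⌉₊) dirCorner (2 * ⌈β ^ θ⌉₊ + 3)
        ((1 / Real.sqrt 2) • (0 : Fin (dimE ρ) → Literature.MathematicalPhysics.QuantumLattice.ZdEdge 4 → ℝ) c))) (x, i, j) ^ 2 = 0 :=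
    Finset.sum_eq_zero fun c _ => by
      rw [Pi.zero_apply, smul_zero, sCirc_glue_zero_mean_zero]; simp
  rw [hF, mul_zero, sub_zero, boxKernelG_one] at key
  exact key

/-- **The centre-plaquette specialisation**: eventually in `β`, for every plane `i < j`,
`|β·∫ c_{(centre;i,j)} d(boxState ρ β ⌈β^θ⌉) − (D/2)·V_D(centre;i,j;⌈β^θ⌉)| ≤ β^{−1/4}`. -/
theorem flatBoxMean_centre_sharp (hρc : Continuous ρ) (hinj : Function.Injective ρ)
    (hρu : ∀ g, ρ g ∈ Matrix.unitaryGroup (Fin N) ℂ) {θ : ℝ} (hθ : 0 < θ) (hθ2 : θ ≤ 1 / 200) :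
    ∃ β₀ : ℝ, ∀ β : ℝ, β₀ ≤ β → ∀ (i j : Fin 4), i < j →
      |β * (∫ U, plaqCostAt ρ (boxCentre ⌈β ^ θ⌉₊) i j U ∂(boxState ρ β ⌈β ^ θ⌉₊)) -
          (dimE ρ : ℝ) / 2 * boxDirProjKernel ⌈β ^ θ⌉₊ (boxCentre ⌈β ^ θ⌉₊, i, j) (boxCentre ⌈β ^ θ⌉₊, i, j)| ≤ β ^ (-(1 / 4 : ℝ)) := by
  obtain ⟨β₀, h⟩ := flatBoxMean_sharp ρ hρc hinj hρu hθ hθ2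
  refine ⟨β₀, fun β hβ i j hij => h β hβ (boxCentre ⌈β ^ θ⌉₊) (fun k => ?_) i j hij⟩
  simp only [boxCentre, sub_self, abs_zero, mul_zero]
  positivity

end Box

/-! ## The Dirichlet variance at the centre is `H`-independent up to `K/H⁴` -/

/-- **The Dirichlet plaquette variance at the centre of the cold box depends on `H` only through `O(H⁻⁴)`**: there is `K ≥ 0` with
`|boxDirProjKernel H (centre_H;i,j) (centre_H;i,j) − boxDirProjKernel H' (centre_{H'};i,j) (centre_{H'};i,j)| ≤ K/H⁴ + K/H'⁴` for all
`H, H' ≥ 32` and every plane `i < j` (the landed `exists_boxDirProjKernel_sub_curl_bound` at the coincident pair: both variances are within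
`K/H⁴` of the coincident value of the `ℤ⁴` curl kernel, which is base-point independent by `curl_greenTensor_self`). -/
theorem abs_boxDirProjKernel_centre_sub_centre_le : ∃ K : ℝ, 0 ≤ K ∧ ∀ (H H' : ℕ), (32 : ℝ) ≤ H → (32 : ℝ) ≤ H' →
    ∀ (i j : Fin 4), i < j →
      |boxDirProjKernel H (boxCentre H, i, j) (boxCentre H, i, j) - boxDirProjKernel H' (boxCentre H', i, j) (boxCentre H', i, j)| ≤
        K / (H : ℝ) ^ 4 + K / (H' : ℝ) ^ 4 := by
  obtain ⟨K, hK0, hK⟩ := exists_boxDirProjKernel_sub_curl_bound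
  refine ⟨K, hK0, fun H H' hH hH' i j hij => ?_⟩
  have hc : ∀ L : ℕ, ‖(boxCentre L : Site 4) - boxCentre L‖ ≤ (L : ℝ) / 8 := fun L => by
    rw [sub_self, norm_zero]; positivity
  have h1 := hK H hH (boxCentre H, i, j) (boxCentre H, i, j) hij hij (hc H) (hc H)
  have h2 := hK H' hH' (boxCentre H', i, j) (boxCentre H', i, j) hij hij (hc H') (hc H')
  simp only at h1 h2
  rw [curl_greenTensor_self] at h1 h2
  rw [abs_sub_comm] at h2
  exact (abs_sub_le _ _ _).trans (add_le_add h1 h2)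

/-! ## The nested-box comparison (stub 2 of crux `TorusMeanNearColdBoxG`, ceiling `1/200`) -/

/-- Real bookkeeping: two means known to `±ε` in `β`-units around `(D/2)·V₁`, `(D/2)·V₂` with `|V₂ − V₁| ≤ 2w` differ by at most
`(2ε + D·w)/β`. -/
theorem abs_sub_le_of_mean_expansions {β E₁ E₂ V₁ V₂ D w ε : ℝ} (hβ : 0 < β) (hD : 0 ≤ D)
    (e₁ : |β * E₁ - D / 2 * V₁| ≤ ε) (e₂ : |β * E₂ - D / 2 * V₂| ≤ ε) (hV : |V₂ - V₁| ≤ 2 * w) :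
    |E₂ - E₁| ≤ (2 * ε + D * w) * β⁻¹ := by
  obtain ⟨l₁, u₁⟩ := abs_le.1 e₁
  obtain ⟨l₂, u₂⟩ := abs_le.1 e₂
  obtain ⟨l₃, u₃⟩ := abs_le.1 hV
  have hup : D / 2 * (V₂ - V₁) ≤ D / 2 * (2 * w) := mul_le_mul_of_nonneg_left u₃ (by positivity)
  have hlo : D / 2 * (-(2 * w)) ≤ D / 2 * (V₂ - V₁) := mul_le_mul_of_nonneg_left l₃ (by positivity)
  have hβE : |β * (E₂ - E₁)| ≤ 2 * ε + D * w := by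
    rw [abs_le]; constructor <;> nlinarith
  have hE : |E₂ - E₁| = β⁻¹ * |β * (E₂ - E₁)| := by
    rw [abs_mul, abs_of_pos hβ, ← mul_assoc, inv_mul_cancel₀ hβ.ne', one_mul]
  rw [hE, mul_comm]
  exact mul_le_mul_of_nonneg_right hβE (inv_nonneg.2 hβ.le)

section Nested

variable {N : ℕ} [NeZero N] {G : Type} [Group G] [TopologicalSpace G] [IsTopologicalGroup G] [CompactSpace G]
  [MeasurableSpace G] [BorelSpace G]
variable (ρ : G →* Matrix (Fin N) (Fin N) ℂ)

/-- **Two nested cold boxes have centre-plaquette means within `2β^{−5/4} + D·K·β^{−1−4θ}`**, every plane: for a faithful continuous unitary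
`ρ : G →* U(N)` and `0 < θ ≤ θ' ≤ 1/200`, eventually in `β`,
`|E_{boxState ρ β ⌈β^θ'⌉}[c_{(centre;i,j)}] − E_{boxState ρ β ⌈β^θ⌉}[c_{(centre;i,j)}]| ≤ 2β^{−5/4} + D·K·β^{−(1+4θ)}`
(`K` the constant of `abs_boxDirProjKernel_centre_sub_centre_le`, `D = dimE ρ`). -/
theorem abs_nestedBoxMeans_sub_le (hρc : Continuous ρ) (hinj : Function.Injective ρ)
    (hρu : ∀ g, ρ g ∈ Matrix.unitaryGroup (Fin N) ℂ) {θ θ' : ℝ} (hθ : 0 < θ) (hθθ' : θ ≤ θ') (hθ'2 : θ' ≤ 1 / 200) :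
    ∃ K : ℝ, 0 ≤ K ∧ ∃ β₀ : ℝ, ∀ β : ℝ, β₀ ≤ β → ∀ (i j : Fin 4), i < j →
      |(∫ U, plaqCostAt ρ (boxCentre ⌈β ^ θ'⌉₊) i j U ∂(boxState ρ β ⌈β ^ θ'⌉₊)) -
          (∫ U, plaqCostAt ρ (boxCentre ⌈β ^ θ⌉₊) i j U ∂(boxState ρ β ⌈β ^ θ⌉₊))| ≤
        2 * β ^ (-(5 / 4 : ℝ)) + (dimE ρ : ℝ) * K * β ^ (-(1 + 4 * θ)) := by
  have hθ' : 0 < θ' := lt_of_lt_of_le hθ hθθ'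
  obtain ⟨K, hK0, hK⟩ := abs_boxDirProjKernel_centre_sub_centre_le
  obtain ⟨β₁, h₁⟩ := flatBoxMean_centre_sharp ρ hρc hinj hρu hθ (hθθ'.trans hθ'2)
  obtain ⟨β₂, h₂⟩ := flatBoxMean_centre_sharp ρ hρc hinj hρu hθ' hθ'2
  refine ⟨K, hK0, max (max β₁ β₂) ((32 : ℝ) ^ (1 / θ)), fun β hβ i j hij => ?_⟩
  have hb₁ : β₁ ≤ β := ((le_max_left _ _).trans (le_max_left _ _)).trans hβ
  have hb₂ : β₂ ≤ β := ((le_max_right _ _).trans (le_max_left _ _)).trans hβ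
  have hb32 : (32 : ℝ) ^ (1 / θ) ≤ β := (le_max_right _ _).trans hβ
  have h32pos : (1 : ℝ) ≤ (32 : ℝ) ^ (1 / θ) := Real.one_le_rpow (by norm_num) (by positivity)
  have hβ1 : 1 ≤ β := h32pos.trans hb32
  have hβ0 : 0 < β := by linarith
  -- box sizes: `32 ≤ β^θ ≤ H`, `β^θ ≤ β^θ' ≤ H'`
  have hβθ : (32 : ℝ) ≤ β ^ θ := by
    have h := Real.rpow_le_rpow (by positivity) hb32 hθ.le
    rwa [← Real.rpow_mul (by norm_num), one_div_mul_cancel hθ.ne', Real.rpow_one] at h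
  have hβθ' : β ^ θ ≤ β ^ θ' := Real.rpow_le_rpow_of_exponent_le hβ1 hθθ'
  have hH : β ^ θ ≤ (⌈β ^ θ⌉₊ : ℝ) := Nat.le_ceil _
  have hH' : β ^ θ' ≤ (⌈β ^ θ'⌉₊ : ℝ) := Nat.le_ceil _
  have hH32 : (32 : ℝ) ≤ (⌈β ^ θ⌉₊ : ℝ) := hβθ.trans hH
  have hH'32 : (32 : ℝ) ≤ (⌈β ^ θ'⌉₊ : ℝ) := (hβθ.trans hβθ').trans hH'
  have hHpos : (0 : ℝ) < (⌈β ^ θ⌉₊ : ℝ) := by linarith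
  have hH'pos : (0 : ℝ) < (⌈β ^ θ'⌉₊ : ℝ) := by linarith
  have hβθpos : 0 < β ^ θ := Real.rpow_pos_of_pos hβ0 _
  -- the four estimates
  have e₁ := h₁ β hb₁ i j hij
  have e₂ := h₂ β hb₂ i j hij
  have v := hK ⌈β ^ θ'⌉₊ ⌈β ^ θ⌉₊ hH'32 hH32 i j hij
  -- `K/H'^4 ≤ K/H^4 ≤ K·β^{-4θ}`
  have hinv : K / (⌈β ^ θ⌉₊ : ℝ) ^ 4 ≤ K * β ^ (-(4 * θ)) := by
    rw [Real.rpow_neg hβ0.le, ← div_eq_mul_inv]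
    have h4 : β ^ (4 * θ) = (β ^ θ) ^ 4 := by
      rw [rpow_theta_pow hβ0.le 4]; norm_num
    rw [h4]
    exact div_le_div_of_nonneg_left hK0 (by positivity) (pow_le_pow_left₀ hβθpos.le hH 4)
  have hHH' : (⌈β ^ θ⌉₊ : ℝ) ≤ (⌈β ^ θ'⌉₊ : ℝ) := by exact_mod_cast Nat.ceil_mono hβθ'
  have hinv' : K / (⌈β ^ θ'⌉₊ : ℝ) ^ 4 ≤ K / (⌈β ^ θ⌉₊ : ℝ) ^ 4 :=
    div_le_div_of_nonneg_left hK0 (by positivity) (pow_le_pow_left₀ hHpos.le hHH' 4)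
  -- combine in `β`-units and divide by `β`
  have hD0 : (0 : ℝ) ≤ (dimE ρ : ℝ) := Nat.cast_nonneg _
  have hV : |boxDirProjKernel ⌈β ^ θ'⌉₊ (boxCentre ⌈β ^ θ'⌉₊, i, j) (boxCentre ⌈β ^ θ'⌉₊, i, j) -
      boxDirProjKernel ⌈β ^ θ⌉₊ (boxCentre ⌈β ^ θ⌉₊, i, j) (boxCentre ⌈β ^ θ⌉₊, i, j)| ≤ 2 * (K * β ^ (-(4 * θ))) := by
    linarith [v, hinv, hinv'.trans hinv]
  have h := abs_sub_le_of_mean_expansions hβ0 hD0 e₁ e₂ hV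
  refine h.trans (le_of_eq ?_)
  have e54 : β ^ (-(1 / 4 : ℝ)) * β⁻¹ = β ^ (-(5 / 4 : ℝ)) := by
    rw [← Real.rpow_neg_one, ← Real.rpow_add hβ0]; norm_num
  have e4θ : β ^ (-(4 * θ)) * β⁻¹ = β ^ (-(1 + 4 * θ)) := by
    rw [← Real.rpow_neg_one, ← Real.rpow_add hβ0]; ring_nf
  calc (2 * β ^ (-(1 / 4 : ℝ)) + (dimE ρ : ℝ) * (K * β ^ (-(4 * θ)))) * β⁻¹
      = 2 * (β ^ (-(1 / 4 : ℝ)) * β⁻¹) + (dimE ρ : ℝ) * K * (β ^ (-(4 * θ)) * β⁻¹) := by ring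
    _ = 2 * β ^ (-(5 / 4 : ℝ)) + (dimE ρ : ℝ) * K * β ^ (-(1 + 4 * θ)) := by rw [e54, e4θ]

end Nested

end Summit.QuantumFields.YangMills.Theorems.ColdBoxAllGroups

namespace Summit.QuantumFields.YangMills.Theorems.SixPlaneColdBox

open Summit.QuantumFields.YangMills.Theorems.ColdBoxAllGroups

/-- **Stub 2 `stub_nestedBoxMeansAgreeG` of the birth skeleton of crux `TorusMeanNearColdBoxG` (stmt-QuantumFields-25708), with the ceiling
`θ' ≤ 1/200` of the mean engine** (the skeleton prints `1/100`; its top scale `θ₁` is free, so `TorusMeanNearColdBoxG_of` composes unchanged with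
stub 1 taken at `θ₁ ≤ 1/200`): for every compact simple `G`, every faithful unitary lattice representation `r`, and exponents
`0 < A < θ ≤ θ' ≤ 1/200`, there is a margin `m > 0` such that for all large `β` and every plane `i < j` the centre-plaquette means of the cold
boxes of half-sides `⌈β^θ⌉ ≤ ⌈β^θ'⌉` satisfy `E_{⌈β^θ'⌉}[c] − E_{⌈β^θ⌉}[c] ≤ β^{−(1+4A+m)}` — flat walls only, no torus: by the sharp one-scale
mean expansion both means are `(D/2β)·V_D(centre) ± β^{−5/4}` and the Dirichlet variances agree to `K/H⁴ ≤ K·β^{−4θ}`. -/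
theorem nestedBoxMeansAgreeG :
    ∀ (G : Type) [Group G] [TopologicalSpace G] [IsTopologicalGroup G] [CompactSpace G],
      IsCompactSimpleLieGroup G →
        letI : MeasurableSpace G := borel G
        haveI : BorelSpace G := ⟨rfl⟩
        ∀ r : LatticeRep G, ∀ A θ θ' : ℝ, 0 < A → A < θ → θ ≤ θ' → θ' ≤ 1 / 200 → ∃ m : ℝ, 0 < m ∧
          ∃ β₀ : ℝ, ∀ β : ℝ, β₀ ≤ β → ∀ i j : Fin 4, i < j →
            (∫ U, plaqCostAt r.ρ (boxCentre ⌈β ^ θ'⌉₊) i j U ∂(boxState r.ρ β ⌈β ^ θ'⌉₊)) -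
                (∫ U, plaqCostAt r.ρ (boxCentre ⌈β ^ θ⌉₊) i j U ∂(boxState r.ρ β ⌈β ^ θ⌉₊)) ≤
              β ^ (-(1 + 4 * A + m)) := by
  intro G _ _ _ _ hG
  letI : MeasurableSpace G := borel G
  haveI : BorelSpace G := ⟨rfl⟩
  intro r A θ θ' hA hAθ hθθ' hθ'2
  haveI : NeZero r.N := ⟨latticeRep_N_ne_zero G hG r⟩
  have hθ : 0 < θ := hA.trans hAθ
  obtain ⟨K, hK0, β₁, hK⟩ := abs_nestedBoxMeans_sub_le r.ρ r.continuous r.injective r.mem_unitary hθ hθθ' hθ'2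
  -- the margin
  set m : ℝ := min (1 / 4 - 4 * A) (4 * (θ - A)) / 2 with hm
  have hA4 : 4 * A < 1 / 4 := by linarith [hAθ.le.trans (hθθ'.trans hθ'2)]
  have hm0 : 0 < m := by
    have : 0 < min (1 / 4 - 4 * A) (4 * (θ - A)) := lt_min (by linarith) (by linarith)
    rw [hm]; linarith
  have hm1 : m < 1 / 4 - 4 * A := by
    have := min_le_left (1 / 4 - 4 * A) (4 * (θ - A)); rw [hm]; linarith
  have hm2 : m < 4 * (θ - A) := by
    have := min_le_right (1 / 4 - 4 * A) (4 * (θ - A)); rw [hm]; linarith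
  -- the two terms are eventually below half the target each
  obtain ⟨β₂, hβ₂1, h₂⟩ := exists_const_mul_rpow_le_rpow (2 * 2) (a := -(5 / 4 : ℝ)) (b := -(1 + 4 * A + m)) (by linarith)
  obtain ⟨β₃, -, h₃⟩ := exists_const_mul_rpow_le_rpow (2 * ((dimE r.ρ : ℝ) * K)) (a := -(1 + 4 * θ)) (b := -(1 + 4 * A + m))
    (by linarith)
  refine ⟨m, hm0, max β₁ (max β₂ β₃), fun β hβ i j hij => ?_⟩
  have hb₁ : β₁ ≤ β := (le_max_left _ _).trans hβ
  have hb₂ : β₂ ≤ β := ((le_max_left _ _).trans (le_max_right _ _)).trans hβ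
  have hb₃ : β₃ ≤ β := ((le_max_right _ _).trans (le_max_right _ _)).trans hβ
  have h := (le_abs_self _).trans (hK β hb₁ i j hij)
  have t₂ := h₂ β hb₂
  have t₃ := h₃ β hb₃
  linarith

end Summit.QuantumFields.YangMills.Theorems.SixPlaneColdBox

end
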